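/-
Copyright (c) 2026 the pub-hodgecm-mathlib formalisation cell (harness21).  Prover seat hodgecm-mathlib-K2E3-p14 (g2), Track B «K2-LIT» ∕ h413
(`stmt-HodgeConjecture-24833`), unit U12 «Harish-Chandra characters» of the line `K2_E3_EllipticInputs`, socket U12-h ‹#9L› `sig_K2E3CharLocConstNearRegular`:
brick (Fr) of the 9L depth-halving road (K2E3-p09 (g2), MEMO v4 §2) — the SPLIT-PLACE variant: levels pulled back along `e : G ≃ₜ* GL_n(F)` (★ `localSplitEquiv`).  2026-09-03.
-/
import Summits.HodgeConjecture.HodgeConjecture.Theorems.K2E3UnitaryCongruenceFrame   -- ★ p855784 (this seat): slice-set lemmas (any group), part 1 ★ p855729 (levels inside `GL_n(F)`, heights); brings ★ `GLnCongruenceSubgroups`, ★ `GLnCongruenceCommutators`, ★ p855559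
import HarnessLib

/-!
# Crux `H413` — K2-LIT E3 «EllipticInputs», U12-h brick (Fr), split-place variant: THE CONGRUENCE FRAME ALONG `e : G ≃ₜ* GL_n(F)` — the levels
# `Kf γ := (congruenceGL n γ).comap e` of `G` are compact open, nested, normalised by `e⁻¹ GL_n(𝒪)`, a neighbourhood basis of `1`, every open subgroup contains a deep one,
# `⁅Kf m, Kf m'⁆ ≤ Kf (m+m')`; the filtration pack in ★ `depthHalving`'s binder shapes; heights of `e`-images on compact sets and on the slice set; compact small torus levels

Cell `hodgecm-mathlib`, Track B «K2-LIT», crux item `stmt-HodgeConjecture-24833` (h413), line `K2_E3_EllipticInputs`, unit U12 «HC characters», socket U12-h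
`sig_K2E3CharLocConstNearRegular` (‹#9L›).  At a SPLIT place `v` (`w ∣ v`, `c • w ≠ w`) the one-place model is ★ `localSplitEquiv : (cmDatum L N H).Local v ≃ₜ* GL (Fin N) (L_w)`
(★ `UnitaryGroupSplitPlace`; consumer token `localSplitEquiv (IsCMField.complexConj L) H (IsCMField.complexConj_ne_one L) (… ▸ hH) w hw (isUnit_placeForm_of_isUnit_det hHd w.1)`
as in ★ p855271), onto the FULL `GL_N(L_w)` rather than a subgroup — so the 9L frame file `K2E3LevelTraceStableFrameSplit` (K2E3-p09 (g2), K2 bus 2026-09-03T23:50:05Z) wants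
the (Fr) transport API of ★ p855784 ∕ ★ p855816 for an isomorphism `e : G ≃ₜ* GL (Fin n) F`.  THIS FILE is that variant, stated for ANY such `e` (the CM split frame is
`e := localSplitEquiv …`): levels `(congruenceGL n γ).comap e.toMulEquiv.toMonoidHom`, to which ALL of ★ `GLnCongruenceCommutators` §4 (`f := e.toMulEquiv.toMonoidHom`) applies
verbatim.  `--supports stmt-HodgeConjecture-24833 --as helper`.  THEOREMS ONLY — no `def`, no named fact, no instance, no notation, no `sorry`.  HONEST LABEL: HC_CM is proved only
modulo the 7 printed citations (2 remaining named inputs: hLiu418 = stmt-HodgeConjecture-24832, h413 = stmt-HodgeConjecture-24833) until rung 0 closes; count-neutral plumbing.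

* §1 (algebra, any topology on `F`): `mem_comapGL_congruenceGL_iff` (`Iff.rfl`), `coe_comapGL_congruenceGL_eq_preimage`, monotone ∕ `|ϖ|^m`-nesting, normalised by `x` with
  `e x ∈ GL_n(𝒪)` in the consumer's bytes `(Kf γ).map (MulAut.conj x).toMonoidHom = Kf γ` and `∀ x ∈ Kf δ, …`, commutators `⁅Kf m, Kf m'⁆ ≤ Kf (m+m')`, and the FILTRATION
  PACK `frameGL_hanti ∕ _hcommf ∕ _hnormf ∕ _hKfle ∕ frameGL_pack ∕ frameGL_hnK ∕ frameGL_le_integral` in ★ `depthHalving`'s (p855781) binder shapes.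
* §2 (topology, `F` a non-archimedean local field): `Kf γ` open (`γ ≠ 0`) and compact, a neighbourhood basis of `1` (units and `|ϖ|^m`), every open subgroup contains some
  `Kf M` (`frameGL_hM`, `frameGL_hM_of_forall` = `depthHalving`'s `hM`), `isOpen_isCompact_frameGL`; heights of `e`-images bounded on compact `S ⊆ G`
  (`exists_height_of_isCompact_transportGL`) and UNIFORMLY ON THE SLICE SET `(K₁ S K₁⁻¹) K₀` for integral `K₁, K₀` (`exists_height_conjSlice_mul_GL`); the torus level
  `Z(γ) ⊓ Kf δ` is compact and `γ · Kf m ⊆ W` for `m` large (`exists_forall_mul_mem_of_mem_nhds_GL`).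

## References
* [BernsteinZelevinsky1976] I. N. Bernstein, A. V. Zelevinsky, *Representations of the group GL(n,F) where F is a non-archimedean local field*, Russian Math. Surveys 31:3
  (1976), §1.1, §3.
* [Casselman1995] W. Casselman, *Introduction to the theory of admissible representations of p-adic reductive groups* (1995), §1.4 Prop. 1.4.4.
* [HarishChandra1999] Harish-Chandra (DeBacker–Sally), *Admissible Invariant Distributions on Reductive p-adic Groups*, ULECT 16 (1999), §17 p. 80, §19 pp. 84–86.
* [PlatonovRapinchuk1994] V. Platonov, A. Rapinchuk, *Algebraic Groups and Number Theory* (1994), §5.1 (the one-place model at a split place: `U(J)(F_v) ≅ GL_N(E_w)`).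
-/

set_option autoImplicit false
-- the mandated namespace repeats `HodgeConjecture.HodgeConjecture`, as in every `Theorems/*.lean` of this sub-problem
set_option linter.dupNamespace false

noncomputable section

open Topology Filter Set ValuativeRel Matrix
open Literature.NumberTheory.Automorphic
open Summit.HodgeConjecture.HodgeConjecture.Cruxes.H413 Summit.HodgeConjecture.HodgeConjecture.Cruxes.H413.K2E3SubgroupCongruenceLevels
  Summit.HodgeConjecture.HodgeConjecture.Cruxes.H413.K2E3UnitaryCongruenceFrame
open scoped MatrixGroups Pointwise

namespace Summit.HodgeConjecture.HodgeConjecture.Cruxes.H413.K2E3CongruenceFrameGL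

/-! ## §1 Algebra of the pulled-back levels `(congruenceGL n γ).comap e` -/

section Algebra

variable {F : Type*} [Field F] [ValuativeRel F] [TopologicalSpace F] {n : ℕ}
  {G : Type*} [Group G] [TopologicalSpace G] (e : G ≃ₜ* GL (Fin n) F)

/-- Membership in `Kf γ = e⁻¹ K_γ` is membership of `e g` in `K_γ` (definitional). [cite: PlatonovRapinchuk1994, §5.1] -/
theorem mem_comapGL_congruenceGL_iff (γ : ValueGroupWithZero F) (g : G) :
    g ∈ (congruenceGL n γ).comap e.toMulEquiv.toMonoidHom ↔ e g ∈ congruenceGL n γ :=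
  Iff.rfl

/-- `Kf γ` as a SET is `e ⁻¹' K_γ`. [cite: PlatonovRapinchuk1994, §5.1] -/
theorem coe_comapGL_congruenceGL_eq_preimage (γ : ValueGroupWithZero F) :
    ((congruenceGL n γ).comap e.toMulEquiv.toMonoidHom : Set G) = e ⁻¹' (congruenceGL n γ : Set (GL (Fin n) F)) :=
  rfl

/-- Monotone in `γ`. [cite: BernsteinZelevinsky1976, §3] -/
theorem comapGL_congruenceGL_mono {γ δ : ValueGroupWithZero F} (h : γ ≤ δ) :
    (congruenceGL n γ).comap e.toMulEquiv.toMonoidHom ≤ (congruenceGL n δ).comap e.toMulEquiv.toMonoidHom :=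
  Subgroup.comap_mono (congruenceGL_mono h)

variable {ϖ : F}

/-- `|ϖ|`-nesting: `Kf m' ≤ Kf m` for `m ≤ m'` (★ `congruenceGL_pow_add_le`). [cite: HarishChandra1999, §17 p. 80] -/
theorem comapGL_congruenceGL_pow_le_of_le (hϖ : IsUniformizingElement ϖ) {m m' : ℕ} (h : m ≤ m') :
    (congruenceGL n (valuation F ϖ ^ m')).comap e.toMulEquiv.toMonoidHom ≤ (congruenceGL n (valuation F ϖ ^ m)).comap e.toMulEquiv.toMonoidHom := by
  obtain ⟨d, rfl⟩ := Nat.exists_eq_add_of_le h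
  exact Subgroup.comap_mono (K2E3CongruenceLayerIntertwiningGL.congruenceGL_pow_add_le hϖ m d)

/-- **NORMALISED BY THE INTEGRAL ELEMENTS** (consumer's bytes): for `x : G` with `e x ∈ GL_n(𝒪)`, `(Kf γ).map (MulAut.conj x).toMonoidHom = Kf γ` (★ `conj_mem_congruenceGL`).
[cite: BernsteinZelevinsky1976, §3] [cite: Casselman1995, §1.4 Prop. 1.4.4] -/
theorem map_conj_comapGL_congruenceGL {x : G} (hx : e x ∈ glInt n F) (γ : ValueGroupWithZero F) :
    ((congruenceGL n γ).comap e.toMulEquiv.toMonoidHom).map (MulAut.conj x).toMonoidHom = (congruenceGL n γ).comap e.toMulEquiv.toMonoidHom := by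
  apply le_antisymm
  · rintro _ ⟨k, hk, rfl⟩
    have hk' : e k ∈ congruenceGL n γ := hk
    show e (x * k * x⁻¹) ∈ congruenceGL n γ
    rw [map_mul, map_mul, map_inv]
    exact conj_mem_congruenceGL hx hk'
  · intro k hk
    have hk' : e k ∈ congruenceGL n γ := hk
    refine ⟨x⁻¹ * k * x, ?_, ?_⟩
    · have h := conj_mem_congruenceGL (Subgroup.inv_mem _ hx) hk'
      rw [inv_inv] at h
      show e (x⁻¹ * k * x) ∈ congruenceGL n γ
      rw [map_mul, map_mul, map_inv]
      exact h
    · show x * (x⁻¹ * k * x) * x⁻¹ = k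
      group

/-- … hence by every element of every level: `∀ x ∈ Kf δ, (Kf γ).map (conj x) = Kf γ` — the `hnK₀`∕`hnK'` binders of ★ p855602 with `K₁ = Kf δ`. [cite: BernsteinZelevinsky1976, §3] -/
theorem forall_map_conj_comapGL_congruenceGL_of_mem (δ γ : ValueGroupWithZero F) :
    ∀ x ∈ (congruenceGL n δ).comap e.toMulEquiv.toMonoidHom,
      ((congruenceGL n γ).comap e.toMulEquiv.toMonoidHom).map (MulAut.conj x).toMonoidHom = (congruenceGL n γ).comap e.toMulEquiv.toMonoidHom :=
  fun _ hx => map_conj_comapGL_congruenceGL e (congruenceGL_le_glInt δ hx) γ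

/-- The same with `K₁ = e⁻¹ GL_n(𝒪)`. [cite: BernsteinZelevinsky1976, §3] -/
theorem forall_map_conj_comapGL_congruenceGL_of_mem_glInt (γ : ValueGroupWithZero F) :
    ∀ x ∈ (glInt n F).comap e.toMulEquiv.toMonoidHom,
      ((congruenceGL n γ).comap e.toMulEquiv.toMonoidHom).map (MulAut.conj x).toMonoidHom = (congruenceGL n γ).comap e.toMulEquiv.toMonoidHom :=
  fun _ hx => map_conj_comapGL_congruenceGL e hx γ

/-- **COMMUTATORS: `⁅Kf m, Kf m'⁆ ≤ Kf (m + m')`** (★ `commutator_comap_congruenceGL_le` along `f = e`). [cite: Casselman1995, §1.4 Prop. 1.4.4] -/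
theorem commutator_comapGL_congruenceGL_pow_le (ϖ : F) (m m' : ℕ) :
    ⁅(congruenceGL n (valuation F ϖ ^ m)).comap e.toMulEquiv.toMonoidHom, (congruenceGL n (valuation F ϖ ^ m')).comap e.toMulEquiv.toMonoidHom⁆ ≤
      (congruenceGL n (valuation F ϖ ^ (m + m'))).comap e.toMulEquiv.toMonoidHom := by
  rw [pow_add]
  exact commutator_comap_congruenceGL_le _ _ _

/-- **FILTRATION PACK, `hanti`**: `m ≤ m' → Kf m' ≤ Kf m` (★ `depthHalving`'s binder order). [cite: HarishChandra1999, §17 p. 80] -/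
theorem frameGL_hanti (hϖ : IsUniformizingElement ϖ) :
    ∀ m m' : ℕ, m ≤ m' → (congruenceGL n (valuation F ϖ ^ m')).comap e.toMulEquiv.toMonoidHom ≤ (congruenceGL n (valuation F ϖ ^ m)).comap e.toMulEquiv.toMonoidHom :=
  fun _ _ h => comapGL_congruenceGL_pow_le_of_le e hϖ h

/-- **`hcommf`** (element form): `a ∈ Kf m`, `b ∈ Kf m'` ⇒ `a b a⁻¹ b⁻¹ ∈ Kf (m + m')` (★ `commutator_mem_comap_congruenceGL`). [cite: Casselman1995, §1.4 Prop. 1.4.4] -/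
theorem frameGL_hcommf (ϖ : F) :
    ∀ m m' : ℕ, ∀ a ∈ (congruenceGL n (valuation F ϖ ^ m)).comap e.toMulEquiv.toMonoidHom, ∀ b ∈ (congruenceGL n (valuation F ϖ ^ m')).comap e.toMulEquiv.toMonoidHom,
      a * b * a⁻¹ * b⁻¹ ∈ (congruenceGL n (valuation F ϖ ^ (m + m'))).comap e.toMulEquiv.toMonoidHom := by
  intro m m' a ha b hb
  rw [pow_add]
  exact commutator_mem_comap_congruenceGL _ ha hb

/-- **`hnormf` for any `K₁` inside `e⁻¹ GL_n(𝒪)`**: `x ∈ K₁`, `a ∈ Kf m` ⇒ `x a x⁻¹ ∈ Kf m` (★ `conj_mem_comap_congruenceGL_of_mem_comap_glInt`). [cite: Casselman1995, §1.4 Prop. 1.4.4] -/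
theorem frameGL_hnormf_of_le_integral {K₁ : Subgroup G} (hK₁ : K₁ ≤ (glInt n F).comap e.toMulEquiv.toMonoidHom) (ϖ : F) :
    ∀ m : ℕ, ∀ x ∈ K₁, ∀ a ∈ (congruenceGL n (valuation F ϖ ^ m)).comap e.toMulEquiv.toMonoidHom, x * a * x⁻¹ ∈ (congruenceGL n (valuation F ϖ ^ m)).comap e.toMulEquiv.toMonoidHom :=
  fun _ _ hx _ ha => conj_mem_comap_congruenceGL_of_mem_comap_glInt _ (hK₁ hx) ha

/-- **`hnormf` with `K₁ = Kf ν`**. [cite: Casselman1995, §1.4 Prop. 1.4.4] -/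
theorem frameGL_hnormf (ϖ : F) (ν : ℕ) :
    ∀ m : ℕ, ∀ x ∈ (congruenceGL n (valuation F ϖ ^ ν)).comap e.toMulEquiv.toMonoidHom, ∀ a ∈ (congruenceGL n (valuation F ϖ ^ m)).comap e.toMulEquiv.toMonoidHom,
      x * a * x⁻¹ ∈ (congruenceGL n (valuation F ϖ ^ m)).comap e.toMulEquiv.toMonoidHom :=
  fun _ _ hx _ ha => conj_mem_comap_congruenceGL _ hx ha

/-- **`hKfle`**: `ν ≤ m → Kf m ≤ Kf ν`. [cite: HarishChandra1999, §17 p. 80] -/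
theorem frameGL_hKfle (hϖ : IsUniformizingElement ϖ) (ν : ℕ) :
    ∀ m : ℕ, ν ≤ m → (congruenceGL n (valuation F ϖ ^ m)).comap e.toMulEquiv.toMonoidHom ≤ (congruenceGL n (valuation F ϖ ^ ν)).comap e.toMulEquiv.toMonoidHom :=
  fun _ h => comapGL_congruenceGL_pow_le_of_le e hϖ h

/-- **THE FILTRATION PACK** `hanti ∧ hcommf ∧ hnormf ∧ hKfle` (`K₁ = Kf ν`) — one `obtain`. [cite: HarishChandra1999, §17 p. 80] [cite: Casselman1995, §1.4 Prop. 1.4.4] -/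
theorem frameGL_pack (hϖ : IsUniformizingElement ϖ) (ν : ℕ) :
    (∀ m m' : ℕ, m ≤ m' → (congruenceGL n (valuation F ϖ ^ m')).comap e.toMulEquiv.toMonoidHom ≤ (congruenceGL n (valuation F ϖ ^ m)).comap e.toMulEquiv.toMonoidHom) ∧
    (∀ m m' : ℕ, ∀ a ∈ (congruenceGL n (valuation F ϖ ^ m)).comap e.toMulEquiv.toMonoidHom, ∀ b ∈ (congruenceGL n (valuation F ϖ ^ m')).comap e.toMulEquiv.toMonoidHom,
      a * b * a⁻¹ * b⁻¹ ∈ (congruenceGL n (valuation F ϖ ^ (m + m'))).comap e.toMulEquiv.toMonoidHom) ∧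
    (∀ m : ℕ, ∀ x ∈ (congruenceGL n (valuation F ϖ ^ ν)).comap e.toMulEquiv.toMonoidHom, ∀ a ∈ (congruenceGL n (valuation F ϖ ^ m)).comap e.toMulEquiv.toMonoidHom,
      x * a * x⁻¹ ∈ (congruenceGL n (valuation F ϖ ^ m)).comap e.toMulEquiv.toMonoidHom) ∧
    (∀ m : ℕ, ν ≤ m → (congruenceGL n (valuation F ϖ ^ m)).comap e.toMulEquiv.toMonoidHom ≤ (congruenceGL n (valuation F ϖ ^ ν)).comap e.toMulEquiv.toMonoidHom) :=
  ⟨frameGL_hanti e hϖ, frameGL_hcommf e ϖ, frameGL_hnormf e ϖ ν, frameGL_hKfle e hϖ ν⟩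

/-- The `hnK₀`∕`hnK'` binder of ★ p855602 at the split frame: `∀ x ∈ Kf ν, (Kf m).map (MulAut.conj x).toMonoidHom = Kf m`. [cite: BernsteinZelevinsky1976, §3] -/
theorem frameGL_hnK (ϖ : F) (ν m : ℕ) :
    ∀ x ∈ (congruenceGL n (valuation F ϖ ^ ν)).comap e.toMulEquiv.toMonoidHom,
      ((congruenceGL n (valuation F ϖ ^ m)).comap e.toMulEquiv.toMonoidHom).map (MulAut.conj x).toMonoidHom = (congruenceGL n (valuation F ϖ ^ m)).comap e.toMulEquiv.toMonoidHom :=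
  forall_map_conj_comapGL_congruenceGL_of_mem e _ _

/-- Every `Kf m` lies in the integral level `e⁻¹ GL_n(𝒪)`. [cite: BernsteinZelevinsky1976, §3] -/
theorem frameGL_le_integral (ϖ : F) (m : ℕ) :
    (congruenceGL n (valuation F ϖ ^ m)).comap e.toMulEquiv.toMonoidHom ≤ (glInt n F).comap e.toMulEquiv.toMonoidHom :=
  Subgroup.comap_mono (congruenceGL_le_glInt _)

end Algebra

/-! ## §2 Topology: compact open, neighbourhood basis, depth, heights, torus levels -/

section TopologyGL

variable {F : Type*} [Field F] [ValuativeRel F] [TopologicalSpace F] [IsNonarchimedeanLocalField F] {n : ℕ}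
  {G : Type*} [Group G] [TopologicalSpace G] (e : G ≃ₜ* GL (Fin n) F)

/-- **`Kf γ` IS OPEN** (`γ ≠ 0`). [cite: BernsteinZelevinsky1976, §1.1] -/
theorem isOpen_comapGL_congruenceGL {γ : ValueGroupWithZero F} (hγ : γ ≠ 0) :
    IsOpen (((congruenceGL n γ).comap e.toMulEquiv.toMonoidHom : Subgroup G) : Set G) := by
  rw [coe_comapGL_congruenceGL_eq_preimage]
  exact (isOpen_congruenceGL hγ).preimage (map_continuous e)

/-- **`Kf γ` IS COMPACT** (`e` is a homeomorphism, ★ `isCompact_congruenceGL`). [cite: BernsteinZelevinsky1976, §1.1] -/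
theorem isCompact_comapGL_congruenceGL (γ : ValueGroupWithZero F) :
    IsCompact (((congruenceGL n γ).comap e.toMulEquiv.toMonoidHom : Subgroup G) : Set G) := by
  rw [coe_comapGL_congruenceGL_eq_preimage]
  exact (HomeomorphClass.toHomeomorph e).isClosedEmbedding.isCompact_preimage (isCompact_congruenceGL γ)

/-- **NEIGHBOURHOOD BASIS OF `1`** (units): every `O ∈ 𝓝 (1 : G)` contains some `Kf γ` (★ `exists_congruenceGL_subset` through `e`). [cite: BernsteinZelevinsky1976, §1.1] -/
theorem exists_comapGL_congruenceGL_subset {O : Set G} (hO : O ∈ 𝓝 (1 : G)) :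
    ∃ γ : (ValueGroupWithZero F)ˣ, (((congruenceGL n (γ : ValueGroupWithZero F)).comap e.toMulEquiv.toMonoidHom : Subgroup G) : Set G) ⊆ O := by
  have hO' : e.symm ⁻¹' O ∈ 𝓝 (1 : GL (Fin n) F) := by
    refine (map_continuous e.symm).continuousAt.preimage_mem_nhds ?_
    rwa [map_one]
  obtain ⟨γ, hγ⟩ := exists_congruenceGL_subset hO'
  refine ⟨γ, fun g hg => ?_⟩
  have h := hγ (show e g ∈ (congruenceGL n (γ : ValueGroupWithZero F) : Set (GL (Fin n) F)) from hg)
  rwa [Set.mem_preimage, ContinuousMulEquiv.symm_apply_apply] at h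

variable {ϖ : F}

/-- The same in the `|ϖ|^m` indexing. [cite: BernsteinZelevinsky1976, §1.1] -/
theorem exists_comapGL_congruenceGL_pow_subset (hϖ0 : ϖ ≠ 0) (hϖ1 : valuation F ϖ < 1) {O : Set G} (hO : O ∈ 𝓝 (1 : G)) :
    ∃ m : ℕ, (((congruenceGL n (valuation F ϖ ^ m)).comap e.toMulEquiv.toMonoidHom : Subgroup G) : Set G) ⊆ O := by
  obtain ⟨γ, hγ⟩ := exists_comapGL_congruenceGL_subset e hO
  obtain ⟨m, hm⟩ := exists_pow_mul_le ((Valuation.ne_zero_iff _).2 hϖ0) hϖ1 (1 : ValueGroupWithZero F) (Units.ne_zero γ)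
  rw [mul_one] at hm
  exact ⟨m, fun k hk => hγ (comapGL_congruenceGL_mono e hm hk)⟩

/-- **`hM` ∕ DEPTH: every open subgroup `K′ ≤ G` contains some `Kf M`** (element form). [cite: BernsteinZelevinsky1976, §1.1] -/
theorem frameGL_hM (hϖ0 : ϖ ≠ 0) (hϖ1 : valuation F ϖ < 1) {K' : Subgroup G} (hK' : IsOpen (K' : Set G)) :
    ∃ M : ℕ, ∀ a ∈ (congruenceGL n (valuation F ϖ ^ M)).comap e.toMulEquiv.toMonoidHom, a ∈ K' := by
  obtain ⟨M, hM⟩ := exists_comapGL_congruenceGL_pow_subset e hϖ0 hϖ1 (hK'.mem_nhds (Subgroup.one_mem K'))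
  exact ⟨M, fun a ha => hM ha⟩

/-- **`hM` of ★ `depthHalving` verbatim**: if the operators `L a`, `a ∈ K′` (`K′` open) fix the vectors satisfying `P`, some `Kf M` does. [cite: HarishChandra1999, §19 pp. 84–86] -/
theorem frameGL_hM_of_forall (hϖ0 : ϖ ≠ 0) (hϖ1 : valuation F ϖ < 1) {K' : Subgroup G} (hK' : IsOpen (K' : Set G)) {W : Type*} (L : G → W → W) (P : W → Prop)
    (hfix : ∀ a ∈ K', ∀ w : W, P w → L a w = w) :
    ∃ M : ℕ, ∀ a ∈ (congruenceGL n (valuation F ϖ ^ M)).comap e.toMulEquiv.toMonoidHom, ∀ w : W, P w → L a w = w := by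
  obtain ⟨M, hM⟩ := frameGL_hM e hϖ0 hϖ1 hK'
  exact ⟨M, fun a ha w hw => hfix a (hM a ha) w hw⟩

/-- `Kf m` is compact open (the `hK₀o`∕`hK₀c`∕`hK₁o`∕`hK₁c` binders of ★ p855602 at `K₀ = Kf N₀`, `K₁ = Kf ν`). [cite: BernsteinZelevinsky1976, §1.1] -/
theorem isOpen_isCompact_frameGL (hϖ0 : ϖ ≠ 0) (m : ℕ) :
    IsOpen (((congruenceGL n (valuation F ϖ ^ m)).comap e.toMulEquiv.toMonoidHom : Subgroup G) : Set G) ∧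
      IsCompact (((congruenceGL n (valuation F ϖ ^ m)).comap e.toMulEquiv.toMonoidHom : Subgroup G) : Set G) :=
  ⟨isOpen_comapGL_congruenceGL e (pow_ne_zero _ ((Valuation.ne_zero_iff _).2 hϖ0)), isCompact_comapGL_congruenceGL e _⟩

/-- **HEIGHTS OF `e`-IMAGES ARE BOUNDED ON COMPACT SUBSETS OF `G`** (★ part 1 `exists_height_of_isCompact` on `e '' S`). [cite: HarishChandra1999, §19 pp. 84–86] -/
theorem exists_height_of_isCompact_transportGL (hϖ0 : ϖ ≠ 0) (hϖ1 : valuation F ϖ < 1) {S : Set G} (hS : IsCompact S) :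
    ∃ h : ℕ, ∀ s ∈ S, ValBound (valuation F ϖ ^ h)⁻¹ ((e s : GL (Fin n) F) : Matrix (Fin n) (Fin n) F) ∧
      ValBound (valuation F ϖ ^ h)⁻¹ (((e s)⁻¹ : GL (Fin n) F) : Matrix (Fin n) (Fin n) F) := by
  obtain ⟨h, hh⟩ := exists_height_of_isCompact hϖ0 hϖ1 (hS.image (map_continuous e))
  exact ⟨h, fun s hs => hh _ (Set.mem_image_of_mem _ hs)⟩

/-- **UNIFORM HEIGHT ON THE SLICE SET `𝒰 = (K₁ S K₁⁻¹) K₀`** for `S` compact and `K₁, K₀ ≤ e⁻¹ GL_n(𝒪)` (the line lead's «`h` bounded» clause at a split place).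
[cite: HarishChandra1999, §19 pp. 84–86] -/
theorem exists_height_conjSlice_mul_GL (hϖ0 : ϖ ≠ 0) (hϖ1 : valuation F ϖ < 1) {S : Set G} (hS : IsCompact S) {K₁ K₀ : Subgroup G}
    (hK₁ : K₁ ≤ (glInt n F).comap e.toMulEquiv.toMonoidHom) (hK₀ : K₀ ≤ (glInt n F).comap e.toMulEquiv.toMonoidHom) :
    ∃ h : ℕ, ∀ y ∈ (fun p : G × G => p.1 * p.2 * p.1⁻¹) '' ((K₁ : Set G) ×ˢ S) * (K₀ : Set G),
      ValBound (valuation F ϖ ^ h)⁻¹ ((e y : GL (Fin n) F) : Matrix (Fin n) (Fin n) F) ∧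
        ValBound (valuation F ϖ ^ h)⁻¹ (((e y)⁻¹ : GL (Fin n) F) : Matrix (Fin n) (Fin n) F) := by
  obtain ⟨h, hh⟩ := exists_height_of_isCompact_transportGL e hϖ0 hϖ1 hS
  refine ⟨h, fun y hy => ?_⟩
  obtain ⟨k, hk, s, hs, k₀, hk₀, rfl⟩ := exists_eq_conj_mul_of_mem_conjSlice_mul hy
  obtain ⟨hs₁, hs₂⟩ := hh s hs
  have key := valBound_conj_mul_of_mem_glInt (hK₁ hk) (hK₀ hk₀) hs₁ hs₂
  simp only [map_mul, map_inv]
  exact key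

/-- **THE TORUS LEVEL `Z(γ) ⊓ Kf δ` IS COMPACT** (`G` Hausdorff). [cite: HarishChandra1999, §19 p. 84] -/
theorem isCompact_centralizer_inf_comapGL_congruenceGL [IsTopologicalGroup G] [T2Space G] (γ : G) (δ : ValueGroupWithZero F) :
    IsCompact ((Subgroup.centralizer ({γ} : Set G) ⊓ (congruenceGL n δ).comap e.toMulEquiv.toMonoidHom : Subgroup G) : Set G) := by
  rw [Subgroup.coe_inf]
  exact (isCompact_comapGL_congruenceGL e δ).inter_left (isClosed_centralizer_singleton γ)

/-- **`γ · Kf m ⊆ W` FOR `m` LARGE**, any `W ∈ 𝓝 γ` (e.g. the regular set). [cite: HarishChandra1999, §19 p. 84] -/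
theorem exists_forall_mul_mem_of_mem_nhds_GL [IsTopologicalGroup G] (hϖ0 : ϖ ≠ 0) (hϖ1 : valuation F ϖ < 1) (γ : G) {W : Set G} (hW : W ∈ 𝓝 γ) :
    ∃ m : ℕ, ∀ t ∈ (congruenceGL n (valuation F ϖ ^ m)).comap e.toMulEquiv.toMonoidHom, γ * t ∈ W := by
  have h1 : (fun t : G => γ * t) ⁻¹' W ∈ 𝓝 (1 : G) := (continuous_const_mul γ).continuousAt.preimage_mem_nhds (by rwa [mul_one])
  obtain ⟨m, hm⟩ := exists_comapGL_congruenceGL_pow_subset e hϖ0 hϖ1 h1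
  exact ⟨m, fun t ht => hm ht⟩

end TopologyGL

end Summit.HodgeConjecture.HodgeConjecture.Cruxes.H413.K2E3CongruenceFrameGL

end
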